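import Mathlib
import Summits.QuantumFields.YangMills.Theses.ToronValleyVolume

/-!
# Assembly item of route `ToronValleyVolume` (⟨stmt-QuantumFields-24500⟩)

`Assembly : ToronTubeVolumeLaw → LojasiewiczLocalise → TauberMeanUpper → VirialFluxGap.PeriodicSoftness` is
literally the route's kernel-checked deciding theorem `Theses.ToronValleyVolume.closes` (planner ym-idea-4 g15, LINE
g15-B «toron-valley volume»: localise by `LojasiewiczLocalise`, bound the mean by `TauberMeanUpper` on the window of the
landed `WindowArithmeticZero`, convert by the landed `deficitFormZero`).

HONEST LABEL: pure glue of a DRAFT-by-design sub-route; the hearts `ToronTubeVolumeLaw` / `LojasiewiczLocalise` stay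
open; no crux, rung or summit is proved; the Yang–Mills mass gap is NOT proved by this.
-/

namespace Summit.QuantumFields.YangMills.Theorems.ToronValleyVolume

/-- ★ Assembly item ⟨stmt-QuantumFields-24500⟩ BY NAME: the three route items give the leaf
`VirialFluxGap.PeriodicSoftness`, by the route's deciding theorem `closes`. -/
theorem assembly_proof : Summit.QuantumFields.YangMills.Theses.ToronValleyVolume.Assembly :=
  fun hV hG hT => Summit.QuantumFields.YangMills.Theses.ToronValleyVolume.closes hV hG hT

end Summit.QuantumFields.YangMills.Theorems.ToronValleyVolume
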